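import Literature.NumberTheory.Irrationality.Zudilin2003.CatalanRecursion
import Summits.KontsevichZagierPeriods.Zeta5Search.RecurrenceGrowth
import HarnessLib

/-!
# ζ(5) search — kernel-certified growth of Zudilin's Catalan denominators `uₙ` (cell `pub-zeta5`, TYPER)

HONEST FRAMING: systematic search; no irrationality claim unless certified.

The Catalan arm (criterion C3) of the certified-asymptotics programme: Zudilin 2003 (Electron. J.
Combin. 10, #R14), the SECOND-order Apéry-like recursion (2) for Catalan's constant, with its
solution `uₙ` (`u₀ = 1, u₁ = 7/4`), typed in the tree as
`Literature.NumberTheory.Irrationality.Zudilin2003.u` (`= sol 1 (7/4)`, `sol_step`). Its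
characteristic polynomial `x² - 11x - 1` has roots of OPPOSITE signs (`(11 ± 5√5)/2`), so the
ratio map `r ↦ sₙ + |tₙ|/r` is decreasing and the tool is
`RecurrenceGrowth.ratio_bounds_of_recurrence_neg` (appended for this purpose). The kernel certifies

* `ratio_bounds` — for every `n ≥ 2`: `uₙ > 0` and `(15/2) uₙ ≤ u_{n+1} ≤ (557/50) uₙ`;
* `u_le`, `le_u` — `(649/64)(15/2)^m ≤ u_{2+m} ≤ (649/64)(557/50)^m`;
* `eventually_u_le_exp` — `uₙ ≤ e^{Q' n}` for all large `n`, for every `Q' > log (557/50) = 2.4105…`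
  (the paper's rate, a named fact `Zudilin2003.rates` in the tree: `log ((11+5√5)/2) = 2.40606…`;
  the lower bracket `15/2` is crude because the box must contain `u₃/u₂ = 7.5004`).

Method: `u_{m+2} = s_m u_{m+1} - t_m u_m` with `s_m = q(m+1)/L_m > 0`,
`t_m = -(2m+1)²(2m+2)² p(m+2)/L_m < 0`, `L_m = (2m+3)²(2m+4)² p(m+1) > 0`; the two corner
inequalities of the box `[15/2, 557/50]` from `m = 2` on are degree-6 polynomials in `k = m - 2`
with NONNEGATIVE integer coefficients (`ring` + `positivity`); `u₂ = 649/64`, `u₃ = 19471/256` by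
`norm_num`. Everything is PROVED (0 sorry); inputs are the tree's definitions only.
-/

noncomputable section

open Filter Topology
open Literature.NumberTheory.Irrationality.Zudilin2003

namespace Summit.KontsevichZagierPeriods.Zeta5Search

namespace Zudilin2003Growth

/-- `uₙ` as a real sequence. -/
def uR (n : ℕ) : ℝ := (u n : ℝ)

/-- Leading coefficient `L_m = (2m+3)²(2m+4)² p(m+1)` of (2) at `n = m+1`. -/
def LC (m : ℕ) : ℝ := (2 * (m : ℝ) + 3) ^ 2 * (2 * (m : ℝ) + 4) ^ 2 * p ((m : ℝ) + 1)

/-- Numerator `(2m+1)²(2m+2)² p(m+2)` of the second coefficient. -/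
def TC (m : ℕ) : ℝ := (2 * (m : ℝ) + 1) ^ 2 * (2 * (m : ℝ) + 2) ^ 2 * p ((m : ℝ) + 2)

/-- `s_m = q(m+1)/L_m`. -/
def sC (m : ℕ) : ℝ := q ((m : ℝ) + 1) / LC m

/-- `t_m = -(2m+1)²(2m+2)² p(m+2)/L_m` (nonpositive). -/
def tC (m : ℕ) : ℝ := -TC m / LC m

/-- `p(m+1) = 20m² + 32m + 13`. -/
theorem p_add_one (m : ℕ) : p ((m : ℝ) + 1) = 20 * (m : ℝ) ^ 2 + 32 * m + 13 := by
  unfold p; ring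

/-- `p(m+2) = 20m² + 72m + 65`. -/
theorem p_add_two (m : ℕ) : p ((m : ℝ) + 2) = 20 * (m : ℝ) ^ 2 + 72 * m + 65 := by
  unfold p; ring

/-- `L_m > 0`. -/
theorem LC_pos (m : ℕ) : 0 < LC m := by
  unfold LC; rw [p_add_one]; positivity

/-- `Tn_m ≥ 0`. -/
theorem TC_nonneg (m : ℕ) : 0 ≤ TC m := by
  unfold TC; rw [p_add_two]; positivity

/-- `t_m ≤ 0`. -/
theorem tC_nonpos (m : ℕ) : tC m ≤ 0 := by
  unfold tC; rw [neg_div]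
  exact neg_nonpos.2 (div_nonneg (TC_nonneg m) (LC_pos m).le)

/-- **The recursion (2) in solved form over `ℝ`**: `u_{m+2} = s_m u_{m+1} - t_m u_m`. -/
theorem uR_rec (m : ℕ) : uR (m + 2) = sC m * uR (m + 1) - tC m * uR m := by
  have hL : LC m ≠ 0 := (LC_pos m).ne'
  have h : u (m + 2) = step m (u m) (u (m + 1)) := by
    unfold u; exact sol_step _ _ m
  have h' := congrArg (fun x : ℚ => (x : ℝ)) h
  simp only [step, p, q] at h'
  push_cast at h'
  unfold uR sC tC TC LC
  simp only [p, q] at hL ⊢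
  rw [h']
  field_simp
  ring

/-! ### Initial data -/

/-- `u₂ = 649/64`. -/
theorem u_two : u 2 = 649 / 64 := by
  have h : u 2 = step 0 (u 0) (u 1) := by unfold u; exact sol_step _ _ 0
  rw [h]; unfold u; rw [sol_zero, sol_one]; norm_num [step, p, q]

/-- `u₃ = 19471/256`. -/
theorem u_three : u 3 = 19471 / 256 := by
  have h : u 3 = step 1 (u 1) (u 2) := by unfold u; exact sol_step _ _ 1
  rw [h, u_two]; unfold u; rw [sol_one]; norm_num [step, p, q]

/-! ### Corner inequalities on the box `[15/2, 557/50]`, from `m = 2` on -/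

/-- Lower corner: `15/2 ≤ s_m - t_m/(557/50)` for `m ≥ 2` (cleared: degree-6 polynomial in
`k = m - 2` with nonnegative coefficients). -/
theorem corner_low (m : ℕ) (hm : 2 ≤ m) : (15 / 2 : ℝ) ≤ sC m - tC m / (557 / 50) := by
  obtain ⟨k, rfl⟩ : ∃ k, m = k + 2 := ⟨m - 2, by omega⟩
  have hL := LC_pos (k + 2)
  have e : sC (k + 2) - tC (k + 2) / (557 / 50) =
      (557 * q (((k + 2 : ℕ) : ℝ) + 1) + 50 * TC (k + 2)) / (557 * LC (k + 2)) := by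
    unfold sC tC; field_simp; ring
  have hP : 100 * (557 * q (((k + 2 : ℕ) : ℝ) + 1) + 50 * TC (k + 2)) -
      100 * ((15 / 2) * (557 * LC (k + 2))) =
      50 * (468806062 + 1203819856 * (k : ℝ) + 1184875996 * (k : ℝ) ^ 2 + 590373616 * (k : ℝ) ^ 3 +
      159547456 * (k : ℝ) ^ 4 + 22376128 * (k : ℝ) ^ 5 + 1279680 * (k : ℝ) ^ 6) := by
    unfold TC LC; simp only [p, q]; push_cast; ring
  rw [e, le_div_iff₀ (by positivity)]
  have h0 : (0 : ℝ) ≤ 100 * (557 * q (((k + 2 : ℕ) : ℝ) + 1) + 50 * TC (k + 2)) -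
      100 * ((15 / 2) * (557 * LC (k + 2))) := by rw [hP]; positivity
  linarith

/-- Upper corner: `s_m - t_m/(15/2) ≤ 557/50` for `m ≥ 2`. -/
theorem corner_up (m : ℕ) (hm : 2 ≤ m) : sC m - tC m / (15 / 2) ≤ (557 / 50 : ℝ) := by
  obtain ⟨k, rfl⟩ : ∃ k, m = k + 2 := ⟨m - 2, by omega⟩
  have hL := LC_pos (k + 2)
  have e : sC (k + 2) - tC (k + 2) / (15 / 2) =
      (15 * q (((k + 2 : ℕ) : ℝ) + 1) + 2 * TC (k + 2)) / (15 * LC (k + 2)) := by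
    unfold sC tC; field_simp; ring
  have hP : 100 * ((557 / 50) * (15 * LC (k + 2))) -
      100 * (15 * q (((k + 2 : ℕ) : ℝ) + 1) + 2 * TC (k + 2)) =
      2 * (1019998710 + 1571586960 * (k : ℝ) + 964647380 * (k : ℝ) ^ 2 + 294897680 * (k : ℝ) ^ 3 +
      44927360 * (k : ℝ) ^ 4 + 2736960 * (k : ℝ) ^ 5 + 1600 * (k : ℝ) ^ 6) := by
    unfold TC LC; simp only [p, q]; push_cast; ring
  rw [e, div_le_iff₀ (by positivity)]
  have h0 : (0 : ℝ) ≤ 100 * ((557 / 50) * (15 * LC (k + 2))) -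
      100 * (15 * q (((k + 2 : ℕ) : ℝ) + 1) + 2 * TC (k + 2)) := by rw [hP]; positivity
  linarith

/-! ### The certified bracket -/

/-- **Kernel-certified ratio bracket for Zudilin's Catalan denominators.** For every `n ≥ 2`:
`uₙ > 0` and `(15/2) uₙ ≤ u_{n+1} ≤ (557/50) uₙ`. -/
theorem ratio_bounds :
    ∀ n, 2 ≤ n → 0 < uR n ∧ 15 / 2 * uR n ≤ uR (n + 1) ∧ uR (n + 1) ≤ 557 / 50 * uR n := by
  refine ratio_bounds_of_recurrence_neg uR sC tC 2 (fun m _ => uR_rec m) (fun m _ => tC_nonpos m)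
    (by norm_num) (by norm_num) (fun m hm => corner_low m hm) (fun m hm => corner_up m hm) ?_ ?_ ?_
  · unfold uR; rw [u_two]; norm_num
  · unfold uR; rw [u_two, u_three]; norm_num
  · unfold uR; rw [u_two, u_three]; norm_num

/-- **Explicit upper bound**: `u_{2+m} ≤ (649/64) · (557/50)^m`. -/
theorem u_le (m : ℕ) : (u (2 + m) : ℝ) ≤ 649 / 64 * (557 / 50) ^ m := by
  have h := le_of_ratio_upper uR 2 (by norm_num : (0 : ℝ) ≤ 557 / 50)
    (fun n hn => (ratio_bounds n hn).2.2) m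
  have h2 : uR 2 = 649 / 64 := by unfold uR; rw [u_two]; norm_num
  rw [h2] at h
  exact h

/-- **Explicit lower bound**: `(649/64) · (15/2)^m ≤ u_{2+m}`. -/
theorem le_u (m : ℕ) : 649 / 64 * (15 / 2 : ℝ) ^ m ≤ (u (2 + m) : ℝ) := by
  have h := le_of_ratio_lower uR 2 (by norm_num : (0 : ℝ) ≤ 15 / 2)
    (fun n hn => (ratio_bounds n hn).2.1) m
  have h2 : uR 2 = 649 / 64 := by unfold uR; rw [u_two]; norm_num
  rw [h2] at h
  exact h

/-- **Growth exponent, upper**: for every `Q' > log (557/50)` (`= 2.4105…`; the paper's rate is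
`log ((11+5√5)/2) = 2.40606…`), `uₙ ≤ e^{Q' n}` for all large `n`. -/
theorem eventually_u_le_exp {Q' : ℝ} (hQ' : Real.log (557 / 50) < Q') :
    ∀ᶠ n : ℕ in atTop, (u n : ℝ) ≤ Real.exp (Q' * n) := by
  have h2 : (0 : ℝ) < uR 2 := by unfold uR; rw [u_two]; norm_num
  exact eventually_le_exp_of_ratio uR 2 (by norm_num : (0 : ℝ) < 557 / 50) h2
    (fun n hn => (ratio_bounds n hn).2.2) hQ'

/-- **Growth exponent, lower**: for every `Q < log (15/2)`, `e^{Q n} ≤ uₙ` for all large `n`. -/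
theorem eventually_exp_le_u {Q : ℝ} (hQ : Q < Real.log (15 / 2)) :
    ∀ᶠ n : ℕ in atTop, Real.exp (Q * n) ≤ (u n : ℝ) := by
  have h2 : (0 : ℝ) < uR 2 := by unfold uR; rw [u_two]; norm_num
  exact eventually_exp_le_of_ratio uR 2 (by norm_num : (0 : ℝ) < 15 / 2) h2
    (fun n hn => (ratio_bounds n hn).2.1) hQ

end Zudilin2003Growth

end Summit.KontsevichZagierPeriods.Zeta5Search
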